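import Literature.Geometry.Riemannian.BamlerFCompactnessAssemblyCompact
import Literature.Geometry.Riemannian.MetricFlowFTotalBoundedness
import Literature.Geometry.Riemannian.MetricFlowFiniteTimeSubconvergence
import Literature.Geometry.Riemannian.MetricFlowKernelSubconvergence
import Literature.Geometry.Riemannian.MetricFlowFCompleteness
import Literature.Geometry.Riemannian.MetricFlowFLimitPair
import Literature.Geometry.Riemannian.MetricFlowFLimitWithin
import HarnessLib

/-!
# Bamler's 𝔽-precompactness of Ricci flows (Bamler 2023, §7.1, Cor. 7.5 with Thm. 7.4 and
# Lemma 7.3) — PROOF of the named fact `bamler_FCompactness_ricciFlow`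

R. Bamler, *Compactness theory of the space of super Ricci flows*, Invent. Math. 233 (2023), §7.1,
Cor. 7.5 (arXiv v1 Cor. 156) with Thm. 7.4 (arXiv v1 Thm. 155) and Lemma 7.3 (arXiv v1 Lemma 154):
a sequence of super Ricci flows on compact manifolds with conjugate heat flows has a subsequence whose
metric flow pairs converge in `d^J_𝔽`. The tree STATED the special case it needs as the named fact
`bamler_FCompactness_ricciFlow` (BamlerFCompactness.lean: Ricci flows of Riemannian metrics on closed
connected `m`-manifolds over a common `[a, T]`, conjugate heat kernel pairs, `J = ∅`, limit
`H_m`-concentrated). This file DISCHARGES it: `bamler_FCompactness_ricciFlow_holds`.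

Proof (the tree's formalization of §5.3–§5.4 and §7.2–§7.3 of the source, assembled):
* ASSEMBLY `bamler_FCompactness_ricciFlow_of_totallyBounded_compact_of_complete`
  (BamlerFCompactnessAssemblyCompact.lean): complete + totally bounded ⇒ sequentially compact, with the
  Lemma 7.3 inputs for Ricci flows (`H_m`-concentration, `Var(ν_{x,T;s}) ≤ H_m (T − s)`, compact slices);
* TOTAL BOUNDEDNESS (§7.3, Lemmas 7.?/arXiv 160, 161, 164, 165 and the proof of Thm. 7.4, `J = ∅`):
  `MetricFlowPair.totalBoundedness_of_finite_subconvergence` (MetricFlowFTotalBoundedness.lean) over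
  `MetricFlowPair.exists_subseq_familyCorrespondence_finite` (MetricFlowFiniteTimeSubconvergence.lean)
  over `exists_subseq_tendsto_map_kernel` (MetricFlowKernelSubconvergence.lean);
* COMPLETENESS (§5.4, Thm. 5.19 / arXiv Thm. 120 with Lemma 5.20 / arXiv Lemma 121, `J = ∅`):
  `completeness_of_limitWithin` (MetricFlowFCompleteness.lean) over
  `MetricFlowPair.limit_fConvergesWithin_of_limitPair` (MetricFlowFLimitWithin.lean) over
  `MetricFlowPair.exists_limitPair_of_chain` (MetricFlowFLimitPair.lean).
No named facts are used: `#print axioms` is `propext`, `Classical.choice`, `Quot.sound`.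

## References

* [Bamler2023] R. H. Bamler, *Compactness theory of the space of super Ricci flows*, Invent. Math. 233
  (2023), 1121–1277 (arXiv:2008.09298), §7.1 Cor. 7.5, Thm. 7.4, Lemma 7.3; §7.2–7.3; §5.3–5.4.
-/

noncomputable section

open Set MeasureTheory Filter
open scoped Topology ENNReal NNReal

namespace Literature.Geometry.Riemannian

/-- **Bamler 2023, §7.1, Cor. 7.5 (with Thm. 7.4 and Lemma 7.3) for Ricci flows — the named fact
`bamler_FCompactness_ricciFlow` HOLDS**: every sequence of Ricci flows of smooth families of Riemannian
metrics on closed connected `m`-manifolds over a common `[a, T]` with base points has a subsequence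
whose conjugate-heat-kernel metric flow pairs converge in `d_𝔽` (`J = ∅`) to an `H_m`-concentrated
metric flow pair over `[a, T]`. Assembled from the tree's total boundedness (§7.3) and completeness
(§5.4) theorems; no hypotheses. [cite: Bamler2023, §7.1, Cor. 7.5; Thm. 7.4; Lemma 7.3] -/
theorem bamler_FCompactness_ricciFlow_holds : bamler_FCompactness_ricciFlow :=
  bamler_FCompactness_ricciFlow_of_totallyBounded_compact_of_complete
    (fun H C a T hH haT P hP hI hvar hcpt ε hε ↦
      MetricFlowPair.totalBoundedness_of_finite_subconvergence
        (fun hH' hV' P' hP' hI' hvar' hcpt' I₀ hI₀ ↦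
          MetricFlowPair.exists_subseq_familyCorrespondence_finite exists_subseq_tendsto_map_kernel
            hH' hV' P' hP' hI' hvar' hcpt' I₀ hI₀)
        H C a T hH haT P hP hI hvar hcpt ε hε)
    (completeness_of_limitWithin fun hH P hP ℭ hZc hZs _ hJ hC ↦
      MetricFlowPair.limit_fConvergesWithin_of_limitPair MetricFlowPair.exists_limitPair_of_chain
        hH P hP ℭ hZc hZs hJ hC)

end Literature.Geometry.Riemannian

end
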